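import Summits.RiemannHypothesis.RiemannHypothesis.Theorems.WeilFormatCCinfRowMonomials
import HarnessLib

/-!
# Format C, design C∞ (E3, analytic side): the remainder constants of the monomial forms are nonnegative

Route context: Fourier–Galerkin / Schur-complement certificates of Weil positivity on a window ("format C", C∞ door;
cell memo `run/shared/lean/pub/rh-explicit/rh-explicit-weil-10/KERNEL-LEVER.md` §21; supporting stmt-RiemannHypothesis-0098;
seat rh-explicit-weil-10).  The kit theorems `cinf_hUq_even/odd` / `weilPositivityOn_of_cinf_poly` ask `0 ≤ ρ_row(n)`,
`0 ≤ ρ_img(q)` for the printed remainder constants of `abs_evenRow/oddRow_sub_monomials_le` and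
`abs_re/im_image_pow_sub_monomials_le` (positivity is not automatic: the digamma remainder has `1 − 1/(4(ω₀/2))` in a
denominator — `archRemainder_nonneg`):

* `evenRow_remainder_nonneg`, `oddRow_remainder_nonneg` — `ρ^±(i,m₀) ≥ 0`;
* `re_image_remainder_nonneg`, `im_image_remainder_nonneg` — `(2a)^{-1/2}ρ_re/im(q,m₀) ≥ 0`.

Elementary; standard axioms; no definitions; no RH claim.
-/

set_option autoImplicit false
-- `Summit.RiemannHypothesis.RiemannHypothesis.…` is the layout-mandated namespace (summit = problem name).
set_option linter.dupNamespace false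

noncomputable section

open Complex Filter Set MeasureTheory
open scoped Real Topology ArithmeticFunction.vonMangoldt

namespace Summit.RiemannHypothesis.RiemannHypothesis.Theorems.WeilFormatC

open Literature.NumberTheory.LFunctions Literature.NumberTheory.LFunctions.Yoshida1992
  Literature.Analysis.SpecialFunctions

variable {a : ℝ}

/-! ## The row remainder constants are nonnegative -/

/-- `ρ⁺(i,m₀) ≥ 0` (for the `hρrow` hypothesis of `cinf_hUq_even`; `πm₀/a ≥ 2`). -/
theorem evenRow_remainder_nonneg (ha : 0 < a) {m₀ : ℕ} (hm₀ : 2 ≤ π * m₀ / a) (i ν K R J : ℕ) :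
    0 ≤ (((4 * Real.pi ^ 2 / 3 * ((2 * ν + 1).factorial : ℝ) / (2 * Real.pi) ^ (2 * ν + 1)
                * (4 * (1 / (4 * (π * m₀ / a / 2)))) ^ (2 * ν)
              + (1 / (4 * (π * m₀ / a / 2))) ^ (K + 1) / ((K + 1) * (1 - 1 / (4 * (π * m₀ / a / 2))))
              + 2 * (1 / (4 * (π * m₀ / a / 2))) ^ (K + 1)
              + ∑ k ∈ Finset.Icc 1 ν, |(bernoulli (2 * k) : ℝ) / (2 * k)| * 2 ^ (K + 1 + 4 * k)
                  * (1 / (4 * (π * m₀ / a / 2))) ^ (K + 1)) / 2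
            + (∑' k : ℕ, Real.exp (-(2 * a * digammaNode k)) * digammaNode k ^ (2 * R))
                / |π * m₀ / a| ^ (2 * R + 1)) / π
            * ∑ j ∈ Finset.range J, (i : ℝ) ^ (2 * j) / (m₀ : ℝ) ^ (2 * j + 1)
          + (2 * (π / 4 + (∑ k ∈ weilPrimeIndex a, (Λ k : ℝ) / Real.sqrt k) + a * (1 + weilArchDensity (2 * a)) / π)
                * (i : ℝ) ^ (2 * J) / π
              + 4 / a * (Real.exp (a / 2) - Real.exp (-(a / 2))) ^ 2 * (a ^ 2 / (4 * π ^ 2)) ^ (J + 1)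
                * (1 / (1 + 4 * freq a i ^ 2))) / (m₀ : ℝ) ^ (2 * J + 1)) := by
  have hΛ : 0 ≤ ∑ k ∈ weilPrimeIndex a, (Λ k : ℝ) / Real.sqrt k :=
    Finset.sum_nonneg fun k _ ↦ div_nonneg ArithmeticFunction.vonMangoldt_nonneg (Real.sqrt_nonneg _)
  have hEa : 0 < weilArchDensity (2 * a) := weilArchDensity_pos (by linarith)
  have hrem := archRemainder_nonneg hm₀ ν K (2 * R + 1)
    (D := ∑' k : ℕ, Real.exp (-(2 * a * digammaNode k)) * digammaNode k ^ (2 * R))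
    (tsum_nonneg fun k ↦ mul_nonneg (Real.exp_nonneg (-(2 * a * digammaNode k))) (pow_nonneg (digammaNode_pos k).le (2 * R)))
  positivity

/-- `ρ⁻(i,m₀) ≥ 0` (for the `hρrow` hypothesis of `cinf_hUq_odd`). -/
theorem oddRow_remainder_nonneg (ha : 0 < a) {m₀ : ℕ} (hm₀ : 2 ≤ π * m₀ / a) (i ν K R J : ℕ) :
    0 ≤ (((4 * Real.pi ^ 2 / 3 * ((2 * ν + 1).factorial : ℝ) / (2 * Real.pi) ^ (2 * ν + 1)
                * (4 * (1 / (4 * (π * m₀ / a / 2)))) ^ (2 * ν)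
              + (1 / (4 * (π * m₀ / a / 2))) ^ (K + 1) / ((K + 1) * (1 - 1 / (4 * (π * m₀ / a / 2))))
              + 2 * (1 / (4 * (π * m₀ / a / 2))) ^ (K + 1)
              + ∑ k ∈ Finset.Icc 1 ν, |(bernoulli (2 * k) : ℝ) / (2 * k)| * 2 ^ (K + 1 + 4 * k)
                  * (1 / (4 * (π * m₀ / a / 2))) ^ (K + 1)) / 2
            + (∑' k : ℕ, Real.exp (-(2 * a * digammaNode k)) * digammaNode k ^ (2 * R))
                / |π * m₀ / a| ^ (2 * R + 1)) / π
            * ∑ j ∈ Finset.range J, (i : ℝ) ^ (2 * j + 1) / (m₀ : ℝ) ^ (2 * j + 2)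
          + (2 * (π / 4 + (∑ k ∈ weilPrimeIndex a, (Λ k : ℝ) / Real.sqrt k) + a * (1 + weilArchDensity (2 * a)) / π)
                * (i : ℝ) ^ (2 * J) / π
              + 4 * (Real.exp (a / 2) - Real.exp (-(a / 2))) ^ 2 / π * (a ^ 2 / (4 * π ^ 2)) ^ J
                * (freq a i / (1 + 4 * freq a i ^ 2))) / (m₀ : ℝ) ^ (2 * J + 1)) := by
  have hΛ : 0 ≤ ∑ k ∈ weilPrimeIndex a, (Λ k : ℝ) / Real.sqrt k :=
    Finset.sum_nonneg fun k _ ↦ div_nonneg ArithmeticFunction.vonMangoldt_nonneg (Real.sqrt_nonneg _)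
  have hEa : 0 < weilArchDensity (2 * a) := weilArchDensity_pos (by linarith)
  have hfi : 0 ≤ freq a i / (1 + 4 * freq a i ^ 2) := by
    have : 0 ≤ freq a i := by rw [freq_natCast]; positivity
    positivity
  have hrem := archRemainder_nonneg hm₀ ν K (2 * R + 1)
    (D := ∑' k : ℕ, Real.exp (-(2 * a * digammaNode k)) * digammaNode k ^ (2 * R))
    (tsum_nonneg fun k ↦ mul_nonneg (Real.exp_nonneg (-(2 * a * digammaNode k))) (pow_nonneg (digammaNode_pos k).le (2 * R)))
  positivity


/-! ## The image remainder constants are nonnegative -/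

/-- `(2a)^{-1/2}ρ_re(q,m₀) ≥ 0` (for the `hρimg` hypothesis of `cinf_hUq_even`; `πm₀/a ≥ 2`). -/
theorem re_image_remainder_nonneg (ha : 0 < a) {m₀ : ℕ} (hm₀ : 2 ≤ π * m₀ / a) (q ν K R J : ℕ) :
    0 ≤ (1 / Real.sqrt (2 * a)) *
          ( |(4 * (∫ x in (-a)..a, x ^ q * Real.cosh (x / 2)) * (Real.exp (a / 2) - Real.exp (-(a / 2))))|
              * ((a ^ 2 / (4 * π ^ 2)) ^ (J + 1) / (m₀ : ℝ) ^ (2 * J + 2))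
            + ∑ k ∈ Finset.range (q + 1), (q.descFactorial k : ℝ) * (a / (π * m₀)) ^ (k + 1) *
                ( |(a ^ (q - k) - (-a) ^ (q - k)) * (I ^ (k + 1)).re| *
                    ((4 * Real.pi ^ 2 / 3 * ((2 * ν + 1).factorial : ℝ) / (2 * Real.pi) ^ (2 * ν + 1)
                      * (4 * (1 / (4 * (π * m₀ / a / 2)))) ^ (2 * ν)
                    + (1 / (4 * (π * m₀ / a / 2))) ^ (K + 1) / ((K + 1) * (1 - 1 / (4 * (π * m₀ / a / 2))))
                    + 2 * (1 / (4 * (π * m₀ / a / 2))) ^ (K + 1)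
                    + ∑ k ∈ Finset.Icc 1 ν, |(bernoulli (2 * k) : ℝ) / (2 * k)| * 2 ^ (K + 1 + 4 * k)
                        * (1 / (4 * (π * m₀ / a / 2))) ^ (K + 1)) / 2
                  + (∑' k : ℕ, Real.exp (-(2 * a * digammaNode k)) * digammaNode k ^ (2 * R + 1))
                      / |π * m₀ / a| ^ (2 * R + 2))
                  + |(a ^ (q - k) + (-a) ^ (q - k)) * (I ^ (k + 1)).im| *
                    ((4 * Real.pi ^ 2 / 3 * ((2 * ν + 1).factorial : ℝ) / (2 * Real.pi) ^ (2 * ν + 1)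
                      * (4 * (1 / (4 * (π * m₀ / a / 2)))) ^ (2 * ν)
                    + (1 / (4 * (π * m₀ / a / 2))) ^ (K + 1) / ((K + 1) * (1 - 1 / (4 * (π * m₀ / a / 2))))
                    + 2 * (1 / (4 * (π * m₀ / a / 2))) ^ (K + 1)
                    + ∑ k ∈ Finset.Icc 1 ν, |(bernoulli (2 * k) : ℝ) / (2 * k)| * 2 ^ (K + 1 + 4 * k)
                        * (1 / (4 * (π * m₀ / a / 2))) ^ (K + 1)) / 2
                  + (∑' k : ℕ, Real.exp (-(2 * a * digammaNode k)) * digammaNode k ^ (2 * R))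
                      / |π * m₀ / a| ^ (2 * R + 1)) ) ) := by
  have hremS := archRemainder_nonneg hm₀ ν K (2 * R + 1)
    (D := ∑' k : ℕ, Real.exp (-(2 * a * digammaNode k)) * digammaNode k ^ (2 * R))
    (tsum_nonneg fun k ↦ mul_nonneg (Real.exp_nonneg (-(2 * a * digammaNode k))) (pow_nonneg (digammaNode_pos k).le (2 * R)))
  have hremC := archRemainder_nonneg hm₀ ν K (2 * R + 2)
    (D := ∑' k : ℕ, Real.exp (-(2 * a * digammaNode k)) * digammaNode k ^ (2 * R + 1))
    (tsum_nonneg fun k ↦ mul_nonneg (Real.exp_nonneg (-(2 * a * digammaNode k)))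
      (pow_nonneg (digammaNode_pos k).le (2 * R + 1)))
  have hm₀ : (0 : ℝ) ≤ m₀ := Nat.cast_nonneg _
  positivity

/-- `(2a)^{-1/2}ρ_im(q,m₀) ≥ 0` (for the `hρimg` hypothesis of `cinf_hUq_odd`). -/
theorem im_image_remainder_nonneg (ha : 0 < a) {m₀ : ℕ} (hm₀ : 2 ≤ π * m₀ / a) (q ν K R J : ℕ) :
    0 ≤ (1 / Real.sqrt (2 * a)) *
          ( |(8 * (∫ x in (-a)..a, x ^ q * Real.sinh (x / 2)) * (Real.exp (a / 2) - Real.exp (-(a / 2))))|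
              * (a / (4 * π) * (a ^ 2 / (4 * π ^ 2)) ^ J / (m₀ : ℝ) ^ (2 * J + 1))
            + ∑ k ∈ Finset.range (q + 1), (q.descFactorial k : ℝ) * (a / (π * m₀)) ^ (k + 1) *
                ( |(a ^ (q - k) - (-a) ^ (q - k)) * (I ^ (k + 1)).im| *
                    ((4 * Real.pi ^ 2 / 3 * ((2 * ν + 1).factorial : ℝ) / (2 * Real.pi) ^ (2 * ν + 1)
                      * (4 * (1 / (4 * (π * m₀ / a / 2)))) ^ (2 * ν)
                    + (1 / (4 * (π * m₀ / a / 2))) ^ (K + 1) / ((K + 1) * (1 - 1 / (4 * (π * m₀ / a / 2))))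
                    + 2 * (1 / (4 * (π * m₀ / a / 2))) ^ (K + 1)
                    + ∑ k ∈ Finset.Icc 1 ν, |(bernoulli (2 * k) : ℝ) / (2 * k)| * 2 ^ (K + 1 + 4 * k)
                        * (1 / (4 * (π * m₀ / a / 2))) ^ (K + 1)) / 2
                  + (∑' k : ℕ, Real.exp (-(2 * a * digammaNode k)) * digammaNode k ^ (2 * R + 1))
                      / |π * m₀ / a| ^ (2 * R + 2))
                  + |(a ^ (q - k) + (-a) ^ (q - k)) * (I ^ (k + 1)).re| *
                    ((4 * Real.pi ^ 2 / 3 * ((2 * ν + 1).factorial : ℝ) / (2 * Real.pi) ^ (2 * ν + 1)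
                      * (4 * (1 / (4 * (π * m₀ / a / 2)))) ^ (2 * ν)
                    + (1 / (4 * (π * m₀ / a / 2))) ^ (K + 1) / ((K + 1) * (1 - 1 / (4 * (π * m₀ / a / 2))))
                    + 2 * (1 / (4 * (π * m₀ / a / 2))) ^ (K + 1)
                    + ∑ k ∈ Finset.Icc 1 ν, |(bernoulli (2 * k) : ℝ) / (2 * k)| * 2 ^ (K + 1 + 4 * k)
                        * (1 / (4 * (π * m₀ / a / 2))) ^ (K + 1)) / 2
                  + (∑' k : ℕ, Real.exp (-(2 * a * digammaNode k)) * digammaNode k ^ (2 * R))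
                      / |π * m₀ / a| ^ (2 * R + 1)) ) ) := by
  have hremS := archRemainder_nonneg hm₀ ν K (2 * R + 1)
    (D := ∑' k : ℕ, Real.exp (-(2 * a * digammaNode k)) * digammaNode k ^ (2 * R))
    (tsum_nonneg fun k ↦ mul_nonneg (Real.exp_nonneg (-(2 * a * digammaNode k))) (pow_nonneg (digammaNode_pos k).le (2 * R)))
  have hremC := archRemainder_nonneg hm₀ ν K (2 * R + 2)
    (D := ∑' k : ℕ, Real.exp (-(2 * a * digammaNode k)) * digammaNode k ^ (2 * R + 1))
    (tsum_nonneg fun k ↦ mul_nonneg (Real.exp_nonneg (-(2 * a * digammaNode k)))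
      (pow_nonneg (digammaNode_pos k).le (2 * R + 1)))
  have hm₀ : (0 : ℝ) ≤ m₀ := Nat.cast_nonneg _
  positivity

end Summit.RiemannHypothesis.RiemannHypothesis.Theorems.WeilFormatC
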